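import Summits.CriticalPhenomena.Ising3DConformalLimit.Theses.CoerciveSharpness
import Summits.CriticalPhenomena.Ising3DConformalLimit.Theorems.CoerciveSharpnessWindowOfGrowthStubReflGradLeMajorant
import Summits.CriticalPhenomena.Ising3DConformalLimit.Theorems.HyperoctahedralRPExistsScaleCovariantLimitFoldedCurrentAxisDcpProfile
import Literature.Barriers.CriticalPhenomena.AxisProfileAxiomaticsNoDoubling
import Literature.Probability.LatticeModels.CriticalTwoPointDCPLowerProofs
import Literature.Probability.LatticeModels.PointwiseScalingLimitEtaExists
import HarnessLib

/-!
# `CoerciveSharpness.WindowOfGrowth` (item stmt-CriticalPhenomena-18198): the two-sided `η`-bounds are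
# load-bearing — growth of the reflected gradient, read on the axis profile, does NOT give the window

Negative knowledge about the crux `Summit.CriticalPhenomena.Ising3DConformalLimit.Theses.CoerciveSharpness.WindowOfGrowth`
(`Growth(κ') → (∃ η, HasIsingEtaBounds 3 η) → WINDOW`), standing crux disprover (D-0016); THEOREM-ONLY,
no definition, no notation. It is the profile-level `WindowOfGrowth_false_without_EtaBounds`:

* `profileGrowth_of_reflectedGradientGrowth` (**faithfulness of the abstraction**): the crux's FIRST
  hypothesis — `c₀ n^{κ'} ≤ Q(n)` for large `n`, `Q` the route's written-out reflected gradient of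
  Duminil-Copin–Panis (arXiv:2404.05700, Thm 1.2) at `β_c(3)` — implies, for the critical axis profile
  `g(k) = ⟨σ₀σ_{k e₀}⟩⁺_{β_c(3)} = criticalTwoPoint 3 (Pi.single 0 k)`, the PROFILE GROWTH
  `c n^{κ'} ≤ g(n)·(1 + Σ_{k≤4n} k² g(k) + n Σ_{k≤2n} k g(k))` for large `n` (same `κ'`): the landed stub
  `stub_reflGrad_le_majorant` (DC–Panis majorant domination, `Q(4n) ≤ 6 Σ majorant`), the tree's summed
  majorant `DCP.sum_majorant_le`, and the box-susceptibility-by-profile bound `dcp_denominator_le_profile`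
  (sup-norm Messager–Miracle-Solé + shell counting). The crux's CONCLUSION is verbatim the profile window
  `∃ ε c > 0, ∀ 1 ≤ m ≤ n, c (n/m)^{-(3/2-ε)} g(m) ≤ g(n)` of that profile, which implies all-scale doubling
  (`axisDoubling_of_profileWindow`).
* `Witness.cube_level_lower`, `Witness.g_cube_lower`, `Witness.profileGrowth_g`: the barrier witness
  `AxisProfileNoDoubling.g` of `Literature.Barriers.CriticalPhenomena.AxisProfileAxiomaticsNoDoubling`
  (a lacunary Källén–Lehmann mixture with every axis-profile fact and NO doubling) satisfies
  `n⁴ g(n)³ ≥ 1/56623104` (i.e. `g(n) ≥ c n^{-4/3}`, sharper than the file's `n^{-3/2}/96`) and hence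
  PROFILE GROWTH with exponent `κ' = 1/3` at every scale `n ≥ 1`.
* `exists_profileGrowth_not_profileWindow`, `not_forall_profileGrowth_imp_profileWindow` (**the negative
  lemma**): "axis-profile facts ∧ Källén–Lehmann shape ∧ profile growth (κ' = 1/3) ⇒ profile window" is
  FALSE. Hence no proof of `WindowOfGrowth` can use its second hypothesis `∃ η, HasIsingEtaBounds 3 η`
  only through profile-level consequences weaker than a two-sided single-exponent power bound (an upper
  envelope, log-convexity, the sliding-scale bound, even a log-sense exponent): the two-sided bounds — the
  route's open-problem item `DimensionPinned` — are load-bearing in `WindowOfGrowth`, exactly as the crux's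
  own risk line says ("fails only if the two-sided bounds are dropped"). The landed line `eta_deficit`
  honours this (it uses `HasIsingEtaBounds` two-sidedly in `windowBelowHalf_of_hasIsingEtaBounds`).

References: M. Aizenman, H. Duminil-Copin, Ann. of Math. 194 (2021), arXiv:1912.07973, Remark 5.10, §5.6
[AizenmanDuminilCopinAnnals2021]; H. Duminil-Copin, R. Panis, Comm. Math. Phys. 406 (2025), arXiv:2404.05700,
Thms 1.2, 1.3, 1.5 [DuminilCopinPanis2025LowerBounds]; A. Messager, S. Miracle-Solé, J. Stat. Phys. 17 (1977)
[MessagerMiracleSoleJSP1977].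
-/

noncomputable section

namespace Summit.CriticalPhenomena.Ising3DConformalLimit.Theorems.WindowOfGrowthNegative

open Finset
open scoped BigOperators
open Literature.Probability.LatticeModels Literature.Barriers.CriticalPhenomena

/-! ### §1 A profile window gives all-scale doubling -/

/-- **A profile window gives all-scale doubling**: `c (n/m)^{-(3/2-ε)} g(m) ≤ g(n)` for `1 ≤ m ≤ n`
at `(m, n) = (n, 2n)` is `κ g(n) ≤ g(2n)` with `κ = c·2^{-(3/2-ε)} > 0` (cf. the tree's
`windowBelowHalf_iff_scaleFactor`). [folklore] -/
theorem axisDoubling_of_profileWindow {g : ℕ → ℝ}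
    (hW : ∃ ε c : ℝ, 0 < ε ∧ 0 < c ∧ ∀ m n : ℕ, 1 ≤ m → m ≤ n →
      c * ((n : ℝ) / m) ^ (-((3 : ℝ) / 2 - ε)) * g m ≤ g n) :
    AxisDoubling g := by
  obtain ⟨ε, c, _hε, hc, hw⟩ := hW
  refine ⟨c * (2 : ℝ) ^ (-((3 : ℝ) / 2 - ε)), mul_pos hc (Real.rpow_pos_of_pos two_pos _),
    fun n hn => ?_⟩
  have h := hw n (2 * n) hn (by omega)
  have hn0 : (n : ℝ) ≠ 0 := by exact_mod_cast (show n ≠ 0 by omega)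
  have h2 : ((2 * n : ℕ) : ℝ) / n = 2 := by
    push_cast
    field_simp
  rw [h2] at h
  exact h

/-! ### §2 The barrier witness has profile growth with exponent `1/3` -/

namespace Witness

open AxisProfileNoDoubling

/-- **`n · h(n)³ ≥ 2⁻¹⁸` for the level function `h(n) = n Z g(n)` of the witness** (`n ≥ 1`): at scale
`n ∈ (M_m, M_{m+1}]`, `M_m = 2^{4m²}`, the episode `j = m + 1` is still on its plateau and
`h(n) ≥ w_j/4`, `w_j = 2^{-(m+1)²}`, while `n·w_j³ ≥ 2^{4m² - 3(m+1)²} ≥ 2^{-12}` because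
`4m² + 12 - 3(m+1)² = (m-3)² ≥ 0`. [folklore] -/
theorem cube_level_lower (n : ℕ) (hn : 1 ≤ n) : (1 / 262144 : ℝ) ≤ n * (level n) ^ 3 := by
  have hn0 : (0 : ℝ) < n := by exact_mod_cast hn
  -- the first episode whose plateau contains `n`
  have hex : ∃ j : ℕ, (n : ℝ) * s j ≤ 1 := by
    refine ⟨n, ?_⟩
    unfold s
    have h1 : (1 / 2 : ℝ) ^ (4 * n ^ 2) ≤ (1 / 2 : ℝ) ^ n :=
      pow_le_pow_of_le_one (by norm_num) (by norm_num) (by nlinarith)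
    have h2 : (n : ℝ) * (1 / 2 : ℝ) ^ n ≤ 1 := by
      rw [one_div_pow, mul_one_div, div_le_one (by positivity)]
      exact_mod_cast (Nat.lt_two_pow_self).le
    calc (n : ℝ) * (1 / 2 : ℝ) ^ (4 * n ^ 2) ≤ n * (1 / 2 : ℝ) ^ n :=
          mul_le_mul_of_nonneg_left h1 hn0.le
      _ ≤ 1 := h2
  classical
  set j := Nat.find hex with hj
  have hjle : (n : ℝ) * s j ≤ 1 := Nat.find_spec hex
  have hn1 : (1 : ℝ) ≤ n := by exact_mod_cast hn
  -- the `j`-th summand is at least `w_j / 4`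
  have hterm : w j / 4 ≤ term n j := by
    unfold term
    have h1 : Real.exp (-1) ≤ Real.exp (-(s j * n)) := Real.exp_le_exp.2 (by nlinarith)
    have h2 : Real.exp (-(3 * (n : ℝ))) ≤ Real.exp (-3) := Real.exp_le_exp.2 (by nlinarith)
    have h3 := quarter_le_exp_neg_one_sub
    have := w_pos j
    nlinarith
  have hlev : w j / 4 ≤ level n := hterm.trans (term_le_level n j)
  -- KEY: `n · w_j³ ≥ 2^{-12}`
  have hkey : (1 / 4096 : ℝ) ≤ n * (w j) ^ 3 := by
    rcases Nat.eq_zero_or_pos j with hj0 | hjpos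
    · rw [hj0, w_zero]
      norm_num
      linarith
    · obtain ⟨m, hm⟩ : ∃ m, j = m + 1 := ⟨j - 1, by omega⟩
      have hmin : ¬ ((n : ℝ) * s m ≤ 1) := Nat.find_min hex (by rw [← hj]; omega)
      push Not at hmin
      -- `n ≥ 2^{4m²}`
      have hnge : (2 : ℝ) ^ (4 * m ^ 2) ≤ n := by
        unfold s at hmin
        rw [one_div_pow, mul_one_div, lt_div_iff₀ (by positivity), one_mul] at hmin
        exact hmin.le
      have hexp : 3 * (m + 1) ^ 2 ≤ 12 + 4 * m ^ 2 := by
        have h := sq_nonneg ((m : ℤ) - 3)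
        zify
        nlinarith [h]
      have hw3 : w (m + 1) ^ 3 = 1 / (2 : ℝ) ^ (3 * (m + 1) ^ 2) := by
        unfold w
        rw [← pow_mul, one_div_pow]
        ring_nf
      rw [hm, hw3, mul_one_div, le_div_iff₀ (by positivity)]
      calc (1 / 4096 : ℝ) * (2 : ℝ) ^ (3 * (m + 1) ^ 2)
          ≤ (1 / 4096) * (2 : ℝ) ^ (12 + 4 * m ^ 2) :=
            mul_le_mul_of_nonneg_left (pow_le_pow_right₀ (by norm_num) hexp) (by norm_num)
        _ = (2 : ℝ) ^ (4 * m ^ 2) := by rw [pow_add]; ring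
        _ ≤ n := hnge
  -- `(4 h(n))³ ≥ w_j³`
  have hw0 : 0 ≤ w j := (w_pos j).le
  have hl3 : (w j) ^ 3 ≤ (4 * level n) ^ 3 := pow_le_pow_left₀ hw0 (by linarith) 3
  have h1 : (n : ℝ) * (w j) ^ 3 ≤ n * (4 * level n) ^ 3 := mul_le_mul_of_nonneg_left hl3 hn0.le
  have h2 : (n : ℝ) * (4 * level n) ^ 3 = 64 * (n * (level n) ^ 3) := by ring
  linarith

/-- **`n⁴ g(n)³ ≥ 1/56623104`** (`= 2⁻¹⁸/216`), i.e. `g(n) ≥ c·n^{-4/3}` at EVERY scale `n ≥ 1`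
(`n g(n) = h(n)/Z`, `Z ≤ 6`): the witness is fat with profile exponent `η = 1/3 < 1/2` in the
lower envelope — sharper than the barrier file's `n^{-3/2}/96`. [folklore] -/
theorem g_cube_lower (n : ℕ) (hn : 1 ≤ n) : (1 / 56623104 : ℝ) ≤ (n : ℝ) ^ 4 * (g n) ^ 3 := by
  have hn0 : (0 : ℝ) < n := by exact_mod_cast hn
  have hl := cube_level_lower n hn
  have hZ := Z_le_six
  have hZ0 := Z_pos
  have hlev : level n = Z * (n * g n) := by
    rw [level_eq hn]
    field_simp
  have hZ3 : Z ^ 3 ≤ 216 := by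
    have := pow_le_pow_left₀ hZ0.le hZ 3
    norm_num at this
    exact this
  have e : (n : ℝ) * (level n) ^ 3 = Z ^ 3 * ((n : ℝ) ^ 4 * (g n) ^ 3) := by
    rw [hlev]; ring
  rw [e] at hl
  -- `2⁻¹⁸ ≤ Z³ · X` with `Z³ ≤ 216` and `X ≥ 0` gives `X ≥ 2⁻¹⁸/216`
  have hX0 : 0 ≤ (n : ℝ) ^ 4 * (g n) ^ 3 := by
    have := (g_pos n).le
    positivity
  nlinarith

/-- **Profile growth with exponent `1/3` for the witness, at every scale**: for `n ≥ 1`,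
`(2c₀²)^{1/3} n^{1/3} ≤ g(n)·(1 + Σ_{k≤4n} k² g(k) + n Σ_{k≤2n} k g(k))`, `c₀ = 1/56623104`:
the shell `2n < k ≤ 4n` of the first profile sum alone gives `Σ k² g(k) ≥ 2n·4n²·g(4n)`
(antitonicity), so the functional is `≥ 8 n³ g(n) g(4n)`, whose cube is
`2n · (n⁴ g(n)³) · ((4n)⁴ g(4n)³) ≥ 2 c₀² n`. [folklore] -/
theorem profileGrowth_g : ∃ c : ℝ, 0 < c ∧ ∀ n : ℕ, 1 ≤ n →
    c * (n : ℝ) ^ ((1 : ℝ) / 3) ≤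
      g n * (1 + ∑ k ∈ Finset.Icc 1 (4 * n), (k : ℝ) ^ 2 * g k +
        (n : ℝ) * ∑ k ∈ Finset.Icc 1 (2 * n), (k : ℝ) * g k) := by
  set c0 : ℝ := 1 / 56623104 with hc0
  have hc0pos : 0 < c0 := by rw [hc0]; norm_num
  refine ⟨(2 * c0 ^ 2) ^ ((1 : ℝ) / 3), by positivity, fun n hn => ?_⟩
  have hn0 : (0 : ℝ) < n := by exact_mod_cast hn
  -- the first profile sum dominates `8 n³ g(4n)`
  have hP : 8 * (n : ℝ) ^ 3 * g (4 * n) ≤ ∑ k ∈ Finset.Icc 1 (4 * n), (k : ℝ) ^ 2 * g k := by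
    calc 8 * (n : ℝ) ^ 3 * g (4 * n)
        = ∑ _k ∈ Finset.Icc (2 * n + 1) (4 * n), (4 * (n : ℝ) ^ 2) * g (4 * n) := by
          rw [Finset.sum_const, Nat.card_Icc, nsmul_eq_mul]
          have : (4 * n + 1 - (2 * n + 1) : ℕ) = 2 * n := by omega
          rw [this]
          push_cast
          ring
      _ ≤ ∑ k ∈ Finset.Icc (2 * n + 1) (4 * n), (k : ℝ) ^ 2 * g k := by
          refine Finset.sum_le_sum fun k hk => ?_
          rw [Finset.mem_Icc] at hk
          have hk2 : 4 * (n : ℝ) ^ 2 ≤ (k : ℝ) ^ 2 := by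
            have : (2 * n : ℝ) ≤ k := by exact_mod_cast (show 2 * n ≤ k by omega)
            nlinarith
          have hgk : g (4 * n) ≤ g k := antitone_g hk.2
          exact mul_le_mul hk2 hgk (g_pos _).le (by positivity)
      _ ≤ ∑ k ∈ Finset.Icc 1 (4 * n), (k : ℝ) ^ 2 * g k :=
          Finset.sum_le_sum_of_subset_of_nonneg (Finset.Icc_subset_Icc (by omega) le_rfl)
            fun k _ _ => mul_nonneg (by positivity) (g_pos k).le
  have hK0 : 0 ≤ (n : ℝ) * ∑ k ∈ Finset.Icc 1 (2 * n), (k : ℝ) * g k :=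
    mul_nonneg hn0.le (Finset.sum_nonneg fun k _ => mul_nonneg (by positivity) (g_pos k).le)
  set B : ℝ := g n * (1 + ∑ k ∈ Finset.Icc 1 (4 * n), (k : ℝ) ^ 2 * g k +
      (n : ℝ) * ∑ k ∈ Finset.Icc 1 (2 * n), (k : ℝ) * g k) with hB
  -- `B ≥ 8 n³ g(n) g(4n)`
  have hgn := (g_pos n).le
  have hBlow : 8 * (n : ℝ) ^ 3 * g n * g (4 * n) ≤ B := by
    have h1 : 8 * (n : ℝ) ^ 3 * g (4 * n) ≤ 1 + ∑ k ∈ Finset.Icc 1 (4 * n), (k : ℝ) ^ 2 * g k +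
        (n : ℝ) * ∑ k ∈ Finset.Icc 1 (2 * n), (k : ℝ) * g k := by linarith
    have h2 := mul_le_mul_of_nonneg_left h1 hgn
    rw [hB]
    linarith [h2]
  have hB0 : 0 ≤ B :=
    le_trans (by have := (g_pos (4 * n)).le; positivity) hBlow
  -- cube it
  have hX := g_cube_lower n hn
  have hY := g_cube_lower (4 * n) (by omega)
  have hXY : c0 * c0 ≤ ((n : ℝ) ^ 4 * (g n) ^ 3) * ((((4 * n : ℕ) : ℝ)) ^ 4 * (g (4 * n)) ^ 3) :=
    mul_le_mul hX hY hc0pos.le (le_trans hc0pos.le hX)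
  have e : (8 * (n : ℝ) ^ 3 * g n * g (4 * n)) ^ 3 =
      2 * n * (((n : ℝ) ^ 4 * (g n) ^ 3) * ((((4 * n : ℕ) : ℝ)) ^ 4 * (g (4 * n)) ^ 3)) := by
    push_cast
    ring
  have hcube : (8 * (n : ℝ) ^ 3 * g n * g (4 * n)) ^ 3 ≤ B ^ 3 :=
    pow_le_pow_left₀ (by have := (g_pos (4 * n)).le; positivity) hBlow 3
  rw [e] at hcube
  have h2n : 2 * (n : ℝ) * (c0 * c0) ≤
      2 * n * (((n : ℝ) ^ 4 * (g n) ^ 3) * ((((4 * n : ℕ) : ℝ)) ^ 4 * (g (4 * n)) ^ 3)) :=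
    mul_le_mul_of_nonneg_left hXY (by positivity)
  have hB3 : 2 * c0 ^ 2 * n ≤ B ^ 3 := by nlinarith [h2n, hcube]
  -- take cube roots
  have hL : (2 * c0 ^ 2 * n : ℝ) ^ ((1 : ℝ) / 3) ≤ (B ^ 3) ^ ((1 : ℝ) / 3) :=
    Real.rpow_le_rpow (by positivity) hB3 (by norm_num)
  have eR : (B ^ 3) ^ ((1 : ℝ) / 3) = B := by
    rw [show ((1 : ℝ) / 3) = ((3 : ℕ) : ℝ)⁻¹ by norm_num]
    exact Real.pow_rpow_inv_natCast hB0 (by norm_num)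
  have eL : (2 * c0 ^ 2 * n : ℝ) ^ ((1 : ℝ) / 3) =
      (2 * c0 ^ 2) ^ ((1 : ℝ) / 3) * (n : ℝ) ^ ((1 : ℝ) / 3) :=
    Real.mul_rpow (by positivity) hn0.le
  rw [eR, eL] at hL
  exact hL

end Witness

/-! ### §3 The negative lemma: profile facts + growth do not give the window -/

open AxisProfileNoDoubling in
/-- **Barrier (existential form).** There is an axis profile `g` with EVERY axis-profile fact of the
critical two-point function (`AxisProfileFacts`: normalisation, positivity, MMS monotonicity, RP
log-convexity, the level envelope, Simon–Lieb, the sliding-scale infrared bound, the DC–Panis bound),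
the full Källén–Lehmann representation, the level function `n g(n)` non-increasing, PROFILE GROWTH
with exponent `κ' = 1/3` at every scale — and yet NO all-scale doubling and NO window.
[cite: AizenmanDuminilCopinAnnals2021, arXiv:1912.07973 Remark 5.10 and §5.6 (all-scale regularity is open and not a consequence of the axis estimates)] -/
theorem exists_profileGrowth_not_profileWindow :
    ∃ g : ℕ → ℝ, AxisProfileFacts g ∧ HasAxisSpectralRepresentation g ∧
      (∀ n : ℕ, 1 ≤ n → ((n : ℝ) + 1) * g (n + 1) ≤ n * g n) ∧
      (∃ κ' c : ℝ, 0 < κ' ∧ 0 < c ∧ ∃ N : ℕ, ∀ n : ℕ, N ≤ n →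
        c * (n : ℝ) ^ κ' ≤ g n * (1 + ∑ k ∈ Finset.Icc 1 (4 * n), (k : ℝ) ^ 2 * g k +
          (n : ℝ) * ∑ k ∈ Finset.Icc 1 (2 * n), (k : ℝ) * g k)) ∧
      ¬ AxisDoubling g ∧
      ¬ (∃ ε c : ℝ, 0 < ε ∧ 0 < c ∧ ∀ m n : ℕ, 1 ≤ m → m ≤ n →
          c * ((n : ℝ) / m) ^ (-((3 : ℝ) / 2 - ε)) * g m ≤ g n) := by
  obtain ⟨c, hc, hgrow⟩ := Witness.profileGrowth_g
  exact ⟨g, axisProfileFacts_g, hasAxisSpectralRepresentation_g, level_antitone_g,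
    ⟨1 / 3, c, by norm_num, hc, 1, fun n hn => hgrow n hn⟩, not_axisDoubling_g,
    fun hW => not_axisDoubling_g (axisDoubling_of_profileWindow hW)⟩

/-- **The negative lemma (technique-class form): "axis-profile facts ∧ Källén–Lehmann shape ∧ profile
growth ⇒ profile window" is FALSE.** Read on the crux `CoerciveSharpness.WindowOfGrowth`
(`Growth → (∃ η, HasIsingEtaBounds 3 η) → WINDOW`): its first hypothesis yields exactly profile growth of
the critical axis profile (`profileGrowth_of_reflectedGradientGrowth` below) and its conclusion IS the
profile window of that profile, so any proof must use the second hypothesis beyond every profile-level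
fact listed — the two-sided single-exponent bounds (route item `DimensionPinned`) are load-bearing; this
is `WindowOfGrowth_false_without_EtaBounds` at the profile level.
[cite: DuminilCopinPanis2025LowerBounds, Theorem 1.3 and Theorem 1.5 (η ≤ 1/2 only, no comparison of two finite scales)] -/
theorem not_forall_profileGrowth_imp_profileWindow :
    ¬ ∀ g : ℕ → ℝ, AxisProfileFacts g → HasAxisSpectralRepresentation g →
      (∃ κ' c : ℝ, 0 < κ' ∧ 0 < c ∧ ∃ N : ℕ, ∀ n : ℕ, N ≤ n →
        c * (n : ℝ) ^ κ' ≤ g n * (1 + ∑ k ∈ Finset.Icc 1 (4 * n), (k : ℝ) ^ 2 * g k +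
          (n : ℝ) * ∑ k ∈ Finset.Icc 1 (2 * n), (k : ℝ) * g k)) →
      (∃ ε c : ℝ, 0 < ε ∧ 0 < c ∧ ∀ m n : ℕ, 1 ≤ m → m ≤ n →
          c * ((n : ℝ) / m) ^ (-((3 : ℝ) / 2 - ε)) * g m ≤ g n) := by
  intro h
  obtain ⟨g, hF, hS, -, hG, -, hW⟩ := exists_profileGrowth_not_profileWindow
  exact hW (h g hF hS hG)

/-! ### §4 The crux's growth hypothesis, read on the critical axis profile -/

/-- The real-variable bookkeeping of `profileGrowth_of_reflectedGradientGrowth`: with `Q ≤ 6(Gχ + (4G/t)S(1+2K))`,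
`S ≤ 81t²`, `χ + tK ≤ 54(1 + P + tK)`, `t g₁ ≤ tK` (`G, K, P ≥ 0`, `t, g₁ > 0`),
`Q ≤ 324(649 + 324/g₁) · G(1 + P + tK)`. [folklore] -/
theorem bracket_algebra {G χ K P S t g₁ Q : ℝ} (ht : 0 < t) (hg₁ : 0 < g₁) (hG : 0 ≤ G)
    (hK : 0 ≤ K) (hP : 0 ≤ P) (hS : S ≤ 81 * t ^ 2)
    (hden : χ + t * K ≤ 54 * (1 + P + t * K)) (hnK : t * g₁ ≤ t * K)
    (hQ : Q ≤ 6 * (G * χ + 4 * G / t * S * (1 + 2 * K))) :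
    Q ≤ 324 * (649 + 324 / g₁) * (G * (1 + P + t * K)) := by
  have hB0 : 0 ≤ 1 + P + t * K := by positivity
  have hχB : χ ≤ 54 * (1 + P + t * K) := by nlinarith [hden, mul_nonneg ht.le hK]
  have hnKB : t * K ≤ 54 * (1 + P + t * K) := by linarith [hden]
  have hnB : t ≤ 54 * (1 + P + t * K) / g₁ := by
    rw [le_div_iff₀ hg₁]
    nlinarith [hnK, hnKB]
  have h12K : 0 ≤ 1 + 2 * K := by linarith
  have ha : 4 * G / t * S ≤ 4 * G / t * (81 * t ^ 2) := mul_le_mul_of_nonneg_left hS (by positivity)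
  have hb : 4 * G / t * (81 * t ^ 2) = 324 * G * t := by
    field_simp
    ring
  have h2nd : 4 * G / t * S * (1 + 2 * K) ≤ 324 * G * t * (1 + 2 * K) := by
    calc 4 * G / t * S * (1 + 2 * K) ≤ 4 * G / t * (81 * t ^ 2) * (1 + 2 * K) :=
          mul_le_mul_of_nonneg_right ha h12K
      _ = 324 * G * t * (1 + 2 * K) := by rw [hb]
  have t1 : G * χ ≤ G * (54 * (1 + P + t * K)) := mul_le_mul_of_nonneg_left hχB hG
  have t2 : 324 * G * t ≤ 324 * G * (54 * (1 + P + t * K) / g₁) :=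
    mul_le_mul_of_nonneg_left hnB (by positivity)
  have t3 : 648 * G * (t * K) ≤ 648 * G * (54 * (1 + P + t * K)) :=
    mul_le_mul_of_nonneg_left hnKB (by positivity)
  have e1 : 324 * G * t * (1 + 2 * K) = 324 * G * t + 648 * G * (t * K) := by ring
  have e2 : 6 * (G * (54 * (1 + P + t * K)) + 324 * G * (54 * (1 + P + t * K) / g₁) +
      648 * G * (54 * (1 + P + t * K))) = 324 * (649 + 324 / g₁) * (G * (1 + P + t * K)) := by
    field_simp
    ring
  nlinarith [hQ, h2nd, t1, t2, t3, e1, e2]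


/-- **Faithfulness of the abstraction.** The first hypothesis of `CoerciveSharpness.WindowOfGrowth`
(verbatim: `c₀ n^{κ'} ≤ Q(n)` for `n ≥ N₀`, `Q` the route's written-out reflected gradient at `β_c(3)`)
implies PROFILE GROWTH of the critical axis profile `g(k) = criticalTwoPoint 3 (Pi.single 0 k)` with the
same exponent: for `n ≥ max N₀ 1`, `c₀ n^{κ'} ≤ c₀(4n)^{κ'} ≤ Q(4n) ≤ 6 Σ_{Λ_{4n}} majorant_n`
(landed stub `stub_reflGrad_le_majorant`) `≤ 6 g(n)·(χ_{4n} + (4/n)(8n+1)²(1 + 2 Σ_{k≤2n} k g(k)))`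
(`DCP.sum_majorant_le`) and `χ_{4n} + n Σ_{k≤2n} k g(k) ≤ 54·(1 + Σ_{k≤4n} k² g(k) + n Σ_{k≤2n} k g(k))`
(`dcp_denominator_le_profile`), the stray `324 n g(n)` being absorbed by `n g(1) ≤ n Σ_{k≤2n} k g(k)`.
[cite: DuminilCopinPanis2025LowerBounds, proof of Theorem 1.3 (p. 5)] -/
theorem profileGrowth_of_reflectedGradientGrowth
    (hA : ∃ κ' c₀ : ℝ, 0 < κ' ∧ 0 < c₀ ∧ ∃ N₀ : ℕ, ∀ n : ℕ, N₀ ≤ n → c₀ * (n : ℝ) ^ κ' ≤ ∑ x ∈ box 3 n, ∑ i : Fin 3, ((if x + Pi.single i 1 ∈ box 3 n then (twoPointFree 3 (criticalBeta 3) x - twoPointFree 3 (criticalBeta 3) (Function.update x (0 : Fin 3) (2 * (n : ℤ) - x 0))) * freeExpect 3 (criticalBeta 3) 0 (spinPair (x + Pi.single i 1) (Function.update (x + Pi.single i 1) (0 : Fin 3) (2 * (n : ℤ) - (x + Pi.single i 1 : Site 3) 0))) else 0) + (if x - Pi.single i 1 ∈ box 3 n then (twoPointFree 3 (criticalBeta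 3) x - twoPointFree 3 (criticalBeta 3) (Function.update x (0 : Fin 3) (2 * (n : ℤ) - x 0))) * freeExpect 3 (criticalBeta 3) 0 (spinPair (x - Pi.single i 1) (Function.update (x - Pi.single i 1) (0 : Fin 3) (2 * (n : ℤ) - (x - Pi.single i 1 : Site 3) 0))) else 0))) :
    ∃ κ' c : ℝ, 0 < κ' ∧ 0 < c ∧ ∃ N : ℕ, ∀ n : ℕ, N ≤ n →
      c * (n : ℝ) ^ κ' ≤ criticalTwoPoint 3 (Pi.single 0 (n : ℤ)) *
        (1 + ∑ k ∈ Finset.Icc 1 (4 * n), (k : ℝ) ^ 2 * criticalTwoPoint 3 (Pi.single 0 (k : ℤ)) +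
          (n : ℝ) * ∑ k ∈ Finset.Icc 1 (2 * n), (k : ℝ) * criticalTwoPoint 3 (Pi.single 0 (k : ℤ))) := by
  obtain ⟨κ', c₀, hκ', hc₀, N₀, hgrow⟩ := hA
  have hg1pos : 0 < criticalTwoPoint 3 (Pi.single 0 ((1 : ℕ) : ℤ)) := criticalTwoPoint_axis_pos 1
  have hApos : 0 < 324 * (649 + 324 / criticalTwoPoint 3 (Pi.single 0 ((1 : ℕ) : ℤ))) := by positivity
  refine ⟨κ', c₀ / (324 * (649 + 324 / criticalTwoPoint 3 (Pi.single 0 ((1 : ℕ) : ℤ)))), hκ',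
    div_pos hc₀ hApos, max N₀ 1, fun n hn => ?_⟩
  have hnN : N₀ ≤ n := le_of_max_le_left hn
  have hn1 : 1 ≤ n := le_of_max_le_right hn
  have ht : (0 : ℝ) < n := by exact_mod_cast hn1
  -- growth at scale `4n`, then stub 1 (DC–Panis majorant domination), then the summed majorant
  have hQ := ((hgrow (4 * n) (by omega)).trans
    (Summit.CriticalPhenomena.Ising3DConformalLimit.Theorems.CoerciveSharpnessWindowOfGrowth.stub_reflGrad_le_majorant
      n hn1)).trans (mul_le_mul_of_nonneg_left (DCP.sum_majorant_le (d' := 2) (0 : Fin 3) hn1) (by norm_num))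
  clear hgrow
  -- `n^{κ'} ≤ (4n)^{κ'}`
  have h4n : c₀ * (n : ℝ) ^ κ' ≤ c₀ * ((4 * n : ℕ) : ℝ) ^ κ' := by
    refine mul_le_mul_of_nonneg_left ?_ hc₀.le
    exact Real.rpow_le_rpow ht.le (by push_cast; linarith) hκ'.le
  -- `n g(1) ≤ n Σ_{k ≤ 2n} k g(k)`
  have hnK : (n : ℝ) * criticalTwoPoint 3 (Pi.single 0 ((1 : ℕ) : ℤ)) ≤
      (n : ℝ) * ∑ k ∈ Finset.Icc 1 (2 * n), (k : ℝ) * criticalTwoPoint 3 (Pi.single 0 (k : ℤ)) := by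
    refine mul_le_mul_of_nonneg_left ?_ ht.le
    have hmem : (1 : ℕ) ∈ Finset.Icc 1 (2 * n) := by
      rw [Finset.mem_Icc]; omega
    have h := Finset.single_le_sum (f := fun k : ℕ => (k : ℝ) * criticalTwoPoint 3 (Pi.single 0 (k : ℤ)))
      (fun k _ => mul_nonneg (by positivity) (criticalTwoPoint_nonneg' _)) hmem
    simpa using h
  -- `(8n+1)² ≤ 81 n²`
  have hsq : ((2 * (4 * n : ℕ) + 1 : ℕ) : ℝ) ^ 2 ≤ 81 * (n : ℝ) ^ 2 := by
    have ht1 : (1 : ℝ) ≤ n := by exact_mod_cast hn1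
    push_cast
    nlinarith
  have key := bracket_algebra ht hg1pos (criticalTwoPoint_nonneg' _)
    (Finset.sum_nonneg fun k _ => mul_nonneg (by positivity) (criticalTwoPoint_nonneg' _))
    (Finset.sum_nonneg fun k _ => mul_nonneg (by positivity) (criticalTwoPoint_nonneg' _))
    hsq
    (Summit.CriticalPhenomena.Ising3DConformalLimit.Cruxes.ExistsScaleCovariantLimit.FoldedCurrentRepulsion.dcp_denominator_le_profile n)
    hnK (h4n.trans hQ)
  rw [div_mul_eq_mul_div, div_le_iff₀ hApos]
  linarith [key]

/-- **The crux's conclusion forces all-scale axial doubling** (`TwoPointDoubling`-shape, item 6150): the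
window `c (n/m)^{-(3/2-ε)} G(m e₁) ≤ G(n e₁)` of `WindowOfGrowth` (= `WindowBelowHalf`, item 5507) is
the profile window of the critical axis profile. [folklore] -/
theorem axisDoubling_of_window
    (hW : ∃ ε c : ℝ, 0 < ε ∧ 0 < c ∧ ∀ m n : ℕ, 1 ≤ m → m ≤ n → c * ((n : ℝ) / m) ^ (-((3:ℝ) / 2 - ε)) * criticalTwoPoint 3 (Pi.single 0 (m : ℤ)) ≤ criticalTwoPoint 3 (Pi.single 0 (n : ℤ))) :
    AxisDoubling (fun k : ℕ => criticalTwoPoint 3 (Pi.single 0 (k : ℤ))) :=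
  axisDoubling_of_profileWindow hW

end Summit.CriticalPhenomena.Ising3DConformalLimit.Theorems.WindowOfGrowthNegative

end
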